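/-
Copyright (c) 2026 the pub-hodgecm-mathlib formalisation cell (harness21).  Prover seat hodgecm-mathlib-A-p19 (g26): T3′ P-2 row (R2²) organ [T2-c], layer 2
«THE MONOGENIC ORDER `𝒪[(u, λ)] ≤ 𝒪 × 𝒪[√k]`: ITS INDEX, LOCALITY, CONDUCTOR AND UNIT INDEX» (road «S3-tree», crux H413).
-/
import Literature.NumberTheory.Automorphic.QuadraticRamifiedOrderUnitIndex   -- ★ p846518 (this seat): `coord_unique`, `coord_mul`, `isUnit_add_mul_iff`, `exists_residueHom`, `index_range_units_map_prod_mul_eq`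
import Literature.NumberTheory.Automorphic.VandermondeLatticeIndex          -- ★ O1 p845514 (F0P3-p02): `natCard_quotient_range_toLin'_eq_natCard_quotient_span_det`, `natCard_quotient_span_singleton_of_valuation_eq`
import HarnessLib

/-!
# The monogenic order `R = 𝒪[x]`, `x = (u, λ)`, in `Λ = 𝒪 × O₁` (`O₁ = j𝒪 ⊕ j𝒪θ`, `θ² = jk₀`): `[Λ : R] = q^{N+n}`, `R` local, `ϖ^{N+n}Λ ⊆ R`, `[Λ^× : R^×] = (q−1)q^{N+n−1}`

Topic `NumberTheory/Automorphic`; namespace `Literature.NumberTheory.Automorphic`.  THEOREMS ONLY (no definition, no instance, no notation, no named fact, no `sorry`); (D0) currency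
`[Field E] [ValuativeRel E]`, `𝒪 = 𝒪[E]` a DVR with finite residue field `𝓀`, `q = Nat.card 𝓀[E]`, `hϖ : IsUniformizingElement ϖ`, and the ABSTRACT ring `O₁ = j𝒪 ⊕ j𝒪θ` of ★
`QuadraticRamifiedOrderUnitIndex` (`hcoord`, `θ² = jk₀`, `k₀ ∈ 𝔪`).  Cell `pub/hodgecm-mathlib`, crux H413 = `stmt-HodgeConjecture-24833`; road «S3-tree», T3′ P-2 row (R2²)
(architect A-p16 (g30) A-106∕A-110), organ [T2-c] «THE UNIT INDEX OF `𝒪_w[δ] ⊂ L_w × K₁`», layer 2: the eigen-data of a deep type-(2) element `δ` of `U(3)(L_w ∕ L⁺_v)` are a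
norm-one `u ≡ 1` and a root `λ = (t + yθ)∕2` of the IRREDUCIBLE `χ_g = X² − tX + D` over `L_w` (`disc χ_g = y²k₀`, `ord y = N`, `ord χ_g(u) = n`, `θ² = k₀` a uniformiser class), and the
order `𝒪_w[δ] ≅ 𝒪_w[x]`, `x = (u, λ) ∈ 𝒪_w × 𝒪[K₁]`.
HONEST LABEL: HC_CM is proved only modulo the 2 remaining named inputs (hLiu418 24832, h413 24833) until rung 0 closes; commutative algebra, asserts nothing printed.

THE MATHEMATICS.  `x = (u, λ)` is killed by the monic cubic `f = (X − u)(X² − tX + D)` (`λ² − tλ + D = 0` as `4D = t² − y²k₀`), so `R := 𝒪[x] = 𝒪 + 𝒪x + 𝒪x²`; in the `𝒪`-basis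
`(1,0), (0,1), (0,θ)` of `Λ` the generators have coordinate matrix `M = [[1, u, u²], [1, e₂t, e₂²(t² + y²k₀)], [0, e₂y, 2e₂²ty]]` (`2e₂ = 1`) with
**`det M = e₂ · y · (u² − tu + D)`**, so **`[Λ : R] = q^{N+n}`** (★ `#(𝒪³ ⧸ M𝒪³) = #(𝒪 ⧸ det M)`) and `det M · Λ ⊆ R` (adjugate), i.e. **`ϖ^{N+n} Λ ⊆ R`**.  `Λ` is integral over the
constants `𝒪 ⊂ R` (cubic equations), so `R^× = R ∩ Λ^×`; with `u ≡ 1`, `e₂t ≡ 1`, an element `p(x) ∈ R` is a unit iff `p(1) ∉ 𝔪`: **`R` is LOCAL with residue field `𝓀`**.  Hence ★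
`index_range_units_map_prod_mul_eq` gives **`[Λ^× : R^×] = (q − 1) · q^{N+n−1}`**.

* §1 `lam_sq_sub`, `aeval_cubic_eq_zero`, `mem_range_iff_exists_deg_lt`; §2 `exists_addEquiv_pi_three`, `det_coordMatrix`, **`index_range_eval₂_eq_pow`**, **`pow_mul_mem_range_eval₂`**;
  §3 `isUnit_iff_of_mem_range_eval₂`, `inv_mem_range_eval₂`, **`isLocalRing_range_eval₂`**, `natCard_residueField_range_eval₂`; §4 **`index_units_range_eval₂_eq`**.

## References
* [Neukirch1999] J. Neukirch, *Algebraic Number Theory*, Grundlehren 322 (1999): Ch. I §12 (orders, conductor and unit index).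
* [SerreLocalFields1979] J.-P. Serre, *Local Fields*, GTM 67 (1979): Ch. I §6 Prop. 17–18 (totally ramified quadratic extensions).
* [StacksProject] The Stacks Project, Tag 02QG (length of a cokernel = order of the determinant).
* [Rogawski1990] J. D. Rogawski, *Automorphic Representations of Unitary Groups in Three Variables* (1990): §4.9 Lemma 4.9.3 p. 56 (where the index is consumed).
-/

set_option autoImplicit false

noncomputable section

open scoped ValuativeRel
open Polynomial Matrix ValuativeRel

namespace Literature.NumberTheory.Automorphic

variable {E : Type*} [Field E] [ValuativeRel E] {O₁ : Type*} [CommRing O₁] (j : 𝒪[E] →+* O₁) (θ : O₁) {k₀ : 𝒪[E]}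
  (hθ : θ ^ 2 = j k₀) (hk₀ : k₀ ∈ IsLocalRing.maximalIdeal 𝒪[E])
  (hcoord : ∀ z : O₁, ∃! bc : 𝒪[E] × 𝒪[E], z = j bc.1 + j bc.2 * θ)
  (u : 𝒪[E]) {t y D e₂ : 𝒪[E]} (h2 : e₂ * 2 = 1) (hD : 4 * D = t * t - y * y * k₀) {lam : O₁} (hlam : lam = j (e₂ * t) + j (e₂ * y) * θ)

/-! ## §1 The cubic equation and the three-term normal form -/

include hθ h2 hD hlam in
/-- `λ² = j(e₂²(t² + y²k₀)) + j(2e₂²ty)θ` and `λ² − j t·λ + j D = 0` (`4D = t² − y²k₀`, `2e₂ = 1`). [cite: SerreLocalFields1979, Ch. I §6] -/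
theorem lam_sq_sub : lam ^ 2 = j (e₂ * e₂ * (t * t + y * y * k₀)) + j (2 * e₂ * e₂ * t * y) * θ ∧ lam ^ 2 - j t * lam + j D = 0 := by
  have hsq : lam ^ 2 = j (e₂ * e₂ * (t * t + y * y * k₀)) + j (2 * e₂ * e₂ * t * y) * θ := by
    rw [hlam, sq, coord_mul j θ hθ]
    congr 1
    · congr 1; ring
    · congr 1; congr 1; ring
  refine ⟨hsq, ?_⟩
  rw [hsq, hlam]
  have hD' : D = e₂ * e₂ * (t * t - y * y * k₀) := by
    calc D = (e₂ * 2) * (e₂ * 2) * D := by rw [h2, one_mul, one_mul]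
      _ = e₂ * e₂ * (4 * D) := by ring
      _ = _ := by rw [hD]
  rw [hD']
  have h2' : j e₂ * 2 = 1 := by
    have := congrArg j h2
    rwa [map_mul, map_ofNat, map_one] at this
  simp only [map_mul, map_add, map_sub, map_ofNat]
  linear_combination (j e₂ * j t * j y * θ + j e₂ * j t ^ 2) * h2'

include hθ h2 hD hlam in
/-- **`x = (u, λ)` IS KILLED BY THE MONIC CUBIC `f = X³ − (t+u)X² + (D+tu)X − uD = (X − u)(X² − tX + D)`** (componentwise). [cite: Neukirch1999, Ch. I §12] -/
theorem eval₂_cubic_eq_zero :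
    Polynomial.eval₂ (RingHom.prod (RingHom.id 𝒪[E]) j) ((u, lam) : 𝒪[E] × O₁)
      (C 1 * X ^ 3 + C (-(t + u)) * X ^ 2 + C (D + t * u) * X + C (-(u * D))) = 0 := by
  obtain ⟨-, hl⟩ := lam_sq_sub j θ hθ h2 hD hlam
  simp only [eval₂_add, eval₂_mul, eval₂_C, eval₂_X_pow, eval₂_X, RingHom.prod_apply, RingHom.id_apply]
  refine Prod.ext ?_ ?_
  · simp only [Prod.fst_add, Prod.fst_mul, Prod.pow_fst, Prod.fst_zero]; ring
  · simp only [Prod.snd_add, Prod.snd_mul, Prod.pow_snd, Prod.snd_zero, map_one, map_neg, map_add, map_mul, one_mul]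
    calc lam ^ 3 + -(j t + j u) * lam ^ 2 + (j D + j t * j u) * lam + -(j u * j D)
        = (lam - j u) * (lam ^ 2 - j t * lam + j D) := by ring
      _ = 0 := by rw [hl, mul_zero]

include hθ h2 hD hlam in
/-- **THREE-TERM NORMAL FORM**: the elements of `R = 𝒪[x]` (the range of `p ↦ p(x)`) are exactly the `(c₀, jc₀) + (c₁, jc₁)x + (c₂, jc₂)x²` (reduce modulo the monic cubic;
Mathlib `modByMonic`, `eval₂_eq_sum_range'`). [cite: Neukirch1999, Ch. I §12] -/
theorem mem_range_eval₂_iff (z : 𝒪[E] × O₁) :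
    z ∈ (Polynomial.eval₂RingHom (RingHom.prod (RingHom.id 𝒪[E]) j) ((u, lam) : 𝒪[E] × O₁)).range ↔
      ∃ c : Fin 3 → 𝒪[E], z = (c 0, j (c 0)) + (c 1, j (c 1)) * (u, lam) + (c 2, j (c 2)) * (u, lam) ^ 2 := by
  classical
  set φ := Polynomial.eval₂RingHom (RingHom.prod (RingHom.id 𝒪[E]) j) ((u, lam) : 𝒪[E] × O₁) with hφ
  set f : (𝒪[E])[X] := C 1 * X ^ 3 + C (-(t + u)) * X ^ 2 + C (D + t * u) * X + C (-(u * D)) with hf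
  have hflead : f.leadingCoeff = 1 := by rw [hf]; exact leadingCoeff_cubic one_ne_zero
  have hfm : f.Monic := hflead
  have hfdeg : f.natDegree = 3 := by rw [hf]; exact natDegree_cubic one_ne_zero
  have hf0 : φ f = 0 := eval₂_cubic_eq_zero j θ hθ u h2 hD hlam
  have hf1 : f ≠ 1 := by
    intro h
    have : f.natDegree = 0 := by rw [h]; exact natDegree_one
    omega
  have hconst : ∀ c : 𝒪[E], φ (C c) = (c, j c) := fun c => by
    rw [hφ, coe_eval₂RingHom, eval₂_C, RingHom.prod_apply, RingHom.id_apply]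
  have hX : φ X = (u, lam) := by rw [hφ, coe_eval₂RingHom, eval₂_X]
  constructor
  · rintro ⟨p, rfl⟩
    have hp : φ p = φ (p %ₘ f) := by
      conv_lhs => rw [← modByMonic_add_div p f]
      rw [map_add, map_mul, hf0, zero_mul, add_zero]
    have hlt : (p %ₘ f).natDegree < 3 := hfdeg ▸ natDegree_modByMonic_lt p hfm hf1
    refine ⟨fun i => (p %ₘ f).coeff i, ?_⟩
    rw [hp, hφ, coe_eval₂RingHom, eval₂_eq_sum_range' _ hlt, Finset.sum_range_succ, Finset.sum_range_succ, Finset.sum_range_succ,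
      Finset.sum_range_zero, zero_add, pow_zero, mul_one, pow_one]
    rfl
  · rintro ⟨c, rfl⟩
    refine ⟨C (c 0) + C (c 1) * X + C (c 2) * X ^ 2, ?_⟩
    rw [map_add, map_add, map_mul, map_mul, map_pow, hconst, hconst, hconst, hX]

/-- The constants `(c, jc)` lie in `R`. [cite: Neukirch1999, Ch. I §12] -/
theorem const_mem_range_eval₂ (c : 𝒪[E]) :
    ((c, j c) : 𝒪[E] × O₁) ∈ (Polynomial.eval₂RingHom (RingHom.prod (RingHom.id 𝒪[E]) j) ((u, lam) : 𝒪[E] × O₁)).range :=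
  ⟨C c, by rw [coe_eval₂RingHom, eval₂_C, RingHom.prod_apply, RingHom.id_apply]⟩

/-- The generator `x = (u, λ)` lies in `R`. [cite: Neukirch1999, Ch. I §12] -/
theorem gen_mem_range_eval₂ :
    ((u, lam) : 𝒪[E] × O₁) ∈ (Polynomial.eval₂RingHom (RingHom.prod (RingHom.id 𝒪[E]) j) ((u, lam) : 𝒪[E] × O₁)).range :=
  ⟨X, by rw [coe_eval₂RingHom, eval₂_X]⟩

/-! ## §2 The coordinate matrix: `[Λ : R] = q^{N+n}` and `ϖ^{N+n} Λ ⊆ R` -/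

include hcoord in
/-- **THE `𝒪`-BASIS `(1,0), (0,1), (0,θ)` OF `Λ`**: `v ↦ (v₀, jv₁ + jv₂θ)` is an additive equivalence `𝒪³ ≃ 𝒪 × O₁`, compatible with the diagonal action of `𝒪`.
[cite: SerreLocalFields1979, Ch. I §6 Prop. 18] -/
theorem exists_addEquiv_pi_three :
    ∃ Ψ : (Fin 3 → 𝒪[E]) ≃+ 𝒪[E] × O₁, (∀ v, Ψ v = (v 0, j (v 1) + j (v 2) * θ)) ∧ ∀ (a : 𝒪[E]) (v : Fin 3 → 𝒪[E]), Ψ (a • v) = (a, j a) * Ψ v := by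
  set Ψ₀ : (Fin 3 → 𝒪[E]) →+ 𝒪[E] × O₁ :=
    { toFun := fun v => (v 0, j (v 1) + j (v 2) * θ)
      map_zero' := by simp
      map_add' := fun v w => by
        simp only [Pi.add_apply, map_add, Prod.mk_add_mk]; congr 1; ring } with hΨ₀
  have happ : ∀ v, Ψ₀ v = (v 0, j (v 1) + j (v 2) * θ) := fun _ => rfl
  have hbij : Function.Bijective Ψ₀ := by
    constructor
    · intro v w h
      rw [happ, happ, Prod.mk.injEq] at h
      have h12 := coord_unique j θ hcoord h.2
      funext i; fin_cases i
      · exact h.1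
      · exact h12.1
      · exact h12.2
    · rintro ⟨a, z⟩
      obtain ⟨⟨b, c⟩, hz, -⟩ := hcoord z
      exact ⟨![a, b, c], by rw [happ]; simp [hz]⟩
  refine ⟨AddEquiv.ofBijective Ψ₀ hbij, fun v => rfl, fun a v => ?_⟩
  change Ψ₀ (a • v) = (a, j a) * Ψ₀ v
  rw [happ, happ, Prod.mk_mul_mk]
  simp only [Pi.smul_apply, smul_eq_mul, map_mul]
  congr 1; ring

include h2 hD in
/-- **THE DETERMINANT OF THE COORDINATE MATRIX** of `1, x, x²` in the basis `(1,0),(0,1),(0,θ)`: `det [[1,u,u²],[1,e₂t,e₂²(t²+y²k₀)],[0,e₂y,2e₂²ty]] = e₂ · y · (u² − tu + D)`.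
[cite: StacksProject, Tag 02QG] -/
theorem det_coordMatrix :
    (!![1, u, u * u; 1, e₂ * t, e₂ * e₂ * (t * t + y * y * k₀); 0, e₂ * y, 2 * e₂ * e₂ * t * y] : Matrix (Fin 3) (Fin 3) 𝒪[E]).det =
      e₂ * y * (u * u - t * u + D) := by
  rw [Matrix.det_fin_three]
  simp
  linear_combination (-(e₂ * e₂ * e₂ * y)) * hD + (e₂ * y * D * (2 * e₂ + 1) - e₂ * t * u * y) * h2

include hθ h2 hD hlam in
/-- The coordinate matrix maps `c = (c₀,c₁,c₂)` to the coordinates of `(c₀, jc₀) + (c₁, jc₁)x + (c₂, jc₂)x²`. [cite: Neukirch1999, Ch. I §12] -/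
theorem addEquiv_mulVec_coordMatrix (Ψ : (Fin 3 → 𝒪[E]) ≃+ 𝒪[E] × O₁) (hΨ : ∀ v, Ψ v = (v 0, j (v 1) + j (v 2) * θ)) (c : Fin 3 → 𝒪[E]) :
    Ψ ((!![1, u, u * u; 1, e₂ * t, e₂ * e₂ * (t * t + y * y * k₀); 0, e₂ * y, 2 * e₂ * e₂ * t * y] : Matrix (Fin 3) (Fin 3) 𝒪[E]) *ᵥ c) =
      (c 0, j (c 0)) + (c 1, j (c 1)) * (u, lam) + (c 2, j (c 2)) * (u, lam) ^ 2 := by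
  obtain ⟨hsq, -⟩ := lam_sq_sub j θ hθ h2 hD hlam
  rw [hΨ, Prod.pow_mk, hsq, hlam]
  refine Prod.ext ?_ ?_
  · simp [Matrix.mulVec, dotProduct, Fin.sum_univ_three]
    ring
  · simp [Matrix.mulVec, dotProduct, Fin.sum_univ_three]
    ring

include hθ h2 hD hlam in
/-- **`R` IN COORDINATES**: the pull-back of `R = 𝒪[x]` along the basis equivalence is the column lattice of the coordinate matrix. [cite: Neukirch1999, Ch. I §12] -/
theorem comap_range_eval₂_eq (Ψ : (Fin 3 → 𝒪[E]) ≃+ 𝒪[E] × O₁) (hΨ : ∀ v, Ψ v = (v 0, j (v 1) + j (v 2) * θ)) :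
    (Polynomial.eval₂RingHom (RingHom.prod (RingHom.id 𝒪[E]) j) ((u, lam) : 𝒪[E] × O₁)).range.toAddSubgroup.comap Ψ.toAddMonoidHom =
      (LinearMap.range (Matrix.toLin'
        (!![1, u, u * u; 1, e₂ * t, e₂ * e₂ * (t * t + y * y * k₀); 0, e₂ * y, 2 * e₂ * e₂ * t * y] : Matrix (Fin 3) (Fin 3) 𝒪[E]))).toAddSubgroup := by
  ext v
  simp only [AddSubgroup.mem_comap, Subring.mem_toAddSubgroup, Submodule.mem_toAddSubgroup, LinearMap.mem_range,
    Matrix.toLin'_apply]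
  rw [RingHom.mem_range]
  change (∃ p, Polynomial.eval₂RingHom _ _ p = Ψ v) ↔ _
  have key := mem_range_eval₂_iff j θ hθ u h2 hD hlam (Ψ v)
  rw [RingHom.mem_range] at key
  rw [key]
  constructor
  · rintro ⟨c, hc⟩
    refine ⟨c, Ψ.injective ?_⟩
    rw [addEquiv_mulVec_coordMatrix j θ hθ u h2 hD hlam Ψ hΨ, ← hc]
  · rintro ⟨c, rfl⟩
    exact ⟨c, addEquiv_mulVec_coordMatrix j θ hθ u h2 hD hlam Ψ hΨ c⟩

variable {ϖ : E} (hϖ : IsUniformizingElement ϖ) {n N : ℕ}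
  (hn : valuation E ((u * u - t * u + D : 𝒪[E]) : E) = valuation E ϖ ^ n) (hN : valuation E ((y : 𝒪[E]) : E) = valuation E ϖ ^ N)

include h2 hD hn hN in
/-- `v(det M) = v(ϖ)^{N+n}` (`e₂` is a unit). [cite: StacksProject, Tag 02QG] -/
theorem valuation_det_coordMatrix :
    valuation E (((!![1, u, u * u; 1, e₂ * t, e₂ * e₂ * (t * t + y * y * k₀); 0, e₂ * y, 2 * e₂ * e₂ * t * y] : Matrix (Fin 3) (Fin 3) 𝒪[E]).det : 𝒪[E]) : E) =
      valuation E ϖ ^ (N + n) := by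
  rw [det_coordMatrix u h2 hD]
  have he₂ : IsUnit e₂ := IsUnit.of_mul_eq_one 2 h2
  have hve : valuation E ((e₂ : 𝒪[E]) : E) = 1 := (Valuation.integer.integers (valuation E)).isUnit_iff_valuation_eq_one.1 he₂
  rw [MulMemClass.coe_mul, MulMemClass.coe_mul, map_mul, map_mul, hve, one_mul, hN, hn, pow_add]

include hθ hcoord h2 hD hlam hϖ hn hN in
/-- **`[Λ : R] = q^{N+n}`** for `R = 𝒪[x] ≤ Λ = 𝒪 × O₁` (`#(𝒪³ ⧸ M𝒪³) = #(𝒪 ⧸ det M)`, ★ O1's PID lemma, and `v(det M) = v(ϖ)^{N+n}`).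
[cite: StacksProject, Tag 02QG] [cite: Neukirch1999, Ch. I §12] -/
theorem index_range_eval₂_eq_pow [IsDiscreteValuationRing 𝒪[E]] :
    (Polynomial.eval₂RingHom (RingHom.prod (RingHom.id 𝒪[E]) j) ((u, lam) : 𝒪[E] × O₁)).range.toAddSubgroup.index = Nat.card 𝓀[E] ^ (N + n) := by
  classical
  obtain ⟨Ψ, hΨ, -⟩ := exists_addEquiv_pi_three j θ hcoord
  set M : Matrix (Fin 3) (Fin 3) 𝒪[E] := !![1, u, u * u; 1, e₂ * t, e₂ * e₂ * (t * t + y * y * k₀); 0, e₂ * y, 2 * e₂ * e₂ * t * y] with hM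
  have hdetv : valuation E ((M.det : 𝒪[E]) : E) = valuation E ϖ ^ (N + n) := valuation_det_coordMatrix (k₀ := k₀) u h2 hD hn hN
  have hdet0 : M.det ≠ 0 := by
    intro h0
    have h' := hdetv
    rw [h0, ZeroMemClass.coe_zero, map_zero] at h'
    exact pow_ne_zero _ ((Valuation.ne_zero_iff _).2 hϖ.ne_zero) h'.symm
  rw [← AddSubgroup.index_comap_of_surjective _ (f := Ψ.toAddMonoidHom) Ψ.surjective, comap_range_eval₂_eq j θ hθ u h2 hD hlam Ψ hΨ]
  have h1 : (LinearMap.range (Matrix.toLin' M)).toAddSubgroup.index = Nat.card ((Fin 3 → 𝒪[E]) ⧸ LinearMap.range (Matrix.toLin' M)) := rfl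
  rw [h1, natCard_quotient_range_toLin'_eq_natCard_quotient_span_det M hdet0, natCard_quotient_span_singleton_of_valuation_eq hϖ hdetv]

include hθ hcoord h2 hD hlam hϖ hn hN in
/-- **THE CONDUCTOR CONTAINS `ϖ^{N+n}`**: `(ϖ^{N+n}, jϖ^{N+n}) · z ∈ R` for every `z ∈ Λ` (`det M · 𝒪³ ⊆ M𝒪³` by the adjugate, and `(det M) = (ϖ^{N+n})`).
[cite: Neukirch1999, Ch. I §12] -/
theorem pow_mul_mem_range_eval₂ (z : 𝒪[E] × O₁) :
    (((⟨ϖ, hϖ.mem⟩ : 𝒪[E]) ^ (N + n), j ((⟨ϖ, hϖ.mem⟩ : 𝒪[E]) ^ (N + n))) : 𝒪[E] × O₁) * z ∈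
      (Polynomial.eval₂RingHom (RingHom.prod (RingHom.id 𝒪[E]) j) ((u, lam) : 𝒪[E] × O₁)).range := by
  classical
  obtain ⟨Ψ, hΨ, hΨsmul⟩ := exists_addEquiv_pi_three j θ hcoord
  set M : Matrix (Fin 3) (Fin 3) 𝒪[E] := !![1, u, u * u; 1, e₂ * t, e₂ * e₂ * (t * t + y * y * k₀); 0, e₂ * y, 2 * e₂ * e₂ * t * y] with hM
  set R := (Polynomial.eval₂RingHom (RingHom.prod (RingHom.id 𝒪[E]) j) ((u, lam) : 𝒪[E] × O₁)).range with hR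
  -- `(det M, j det M) · z ∈ R`
  have hdetz : ((M.det, j M.det) : 𝒪[E] × O₁) * z ∈ R := by
    obtain ⟨v, rfl⟩ := Ψ.surjective z
    rw [← hΨsmul]
    have hv : M.det • v = M *ᵥ (M.adjugate *ᵥ v) := by
      rw [Matrix.mulVec_mulVec, Matrix.mul_adjugate, Matrix.smul_mulVec, Matrix.one_mulVec]
    have hmem : M.det • v ∈ R.toAddSubgroup.comap Ψ.toAddMonoidHom := by
      rw [comap_range_eval₂_eq j θ hθ u h2 hD hlam Ψ hΨ, Submodule.mem_toAddSubgroup, LinearMap.mem_range]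
      exact ⟨M.adjugate *ᵥ v, by rw [Matrix.toLin'_apply, ← hv]⟩
    exact AddSubgroup.mem_comap.1 hmem
  -- `(ϖ^{N+n}) = (det M)`
  have hdetv : valuation E ((M.det : 𝒪[E]) : E) = valuation E ϖ ^ (N + n) := valuation_det_coordMatrix (k₀ := k₀) u h2 hD hn hN
  have hspan := span_singleton_eq_span_uniformizer_pow_of_valuation_eq hϖ hdetv
  have hmemsp : (⟨ϖ, hϖ.mem⟩ : 𝒪[E]) ^ (N + n) ∈ Ideal.span ({M.det} : Set 𝒪[E]) := by
    rw [hspan]; exact Ideal.mem_span_singleton_self _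
  obtain ⟨c, hc⟩ := Ideal.mem_span_singleton'.1 hmemsp
  have heq : (((⟨ϖ, hϖ.mem⟩ : 𝒪[E]) ^ (N + n), j ((⟨ϖ, hϖ.mem⟩ : 𝒪[E]) ^ (N + n))) : 𝒪[E] × O₁) * z =
      ((c, j c) : 𝒪[E] × O₁) * (((M.det, j M.det) : 𝒪[E] × O₁) * z) := by
    rw [← hc, map_mul]
    refine Prod.ext ?_ ?_
    · simp only [Prod.fst_mul]; ring
    · simp only [Prod.snd_mul]; ring
  rw [heq]
  exact R.mul_mem (const_mem_range_eval₂ j u c) hdetz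

/-! ## §3 `R` is local with residue field `𝓀` -/

variable (hu1 : u - 1 ∈ IsLocalRing.maximalIdeal 𝒪[E]) (ht2 : t - 2 ∈ IsLocalRing.maximalIdeal 𝒪[E])

include hθ hk₀ hcoord h2 hD hlam hu1 ht2 in
/-- **UNITS OF `R` ARE DETECTED ON THE FIRST COORDINATE**: for `z ∈ R = 𝒪[x]`, `z` is a unit of `Λ` iff `z.1` is a unit of `𝒪` (`u ≡ 1`, `e₂t ≡ 1`, `y²k₀ ≡ 0`, so both
coordinates of `c₀ + c₁x + c₂x²` are `≡ c₀ + c₁ + c₂`; ★ `isUnit_add_mul_iff`). [cite: Neukirch1999, Ch. I §12] [cite: SerreLocalFields1979, Ch. I §6 Prop. 17] -/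
theorem isUnit_iff_isUnit_fst_of_mem_range {z : 𝒪[E] × O₁}
    (hz : z ∈ (Polynomial.eval₂RingHom (RingHom.prod (RingHom.id 𝒪[E]) j) ((u, lam) : 𝒪[E] × O₁)).range) :
    IsUnit z ↔ IsUnit z.1 := by
  obtain ⟨c, rfl⟩ := (mem_range_eval₂_iff j θ hθ u h2 hD hlam z).1 hz
  obtain ⟨hsq, -⟩ := lam_sq_sub j θ hθ h2 hD hlam
  -- the two coordinates
  set a : 𝒪[E] := c 0 + c 1 * u + c 2 * (u * u) with ha
  set b : 𝒪[E] := c 0 + c 1 * (e₂ * t) + c 2 * (e₂ * e₂ * (t * t + y * y * k₀)) with hb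
  set b' : 𝒪[E] := c 1 * (e₂ * y) + c 2 * (2 * e₂ * e₂ * t * y) with hb'
  have hz1 : ((c 0, j (c 0)) + (c 1, j (c 1)) * (u, lam) + (c 2, j (c 2)) * (u, lam) ^ 2 : 𝒪[E] × O₁) = (a, j b + j b' * θ) := by
    rw [Prod.pow_mk, hsq, hlam, ha, hb, hb']
    refine Prod.ext ?_ ?_
    · simp only [Prod.fst_add, Prod.fst_mul]; ring
    · simp only [Prod.snd_add, Prod.snd_mul, map_add, map_mul, map_ofNat]; ring
  rw [hz1, Prod.isUnit_iff]
  simp only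
  rw [isUnit_add_mul_iff j θ hθ hk₀ hcoord]
  -- `a ≡ b (mod 𝔪)`
  have hab : a - b ∈ IsLocalRing.maximalIdeal 𝒪[E] := by
    have e1 : a - b = c 1 * (u - 1) - c 1 * e₂ * (t - 2) + c 2 * (u + 1) * (u - 1) - c 2 * e₂ * (t - 2) * (e₂ * t + 1)
        - c 2 * e₂ * e₂ * (y * y) * k₀ := by
      rw [ha, hb]; linear_combination (-(c 1) - c 2 * (e₂ * t + 1)) * h2
    rw [e1]
    refine Ideal.sub_mem _ (Ideal.sub_mem _ (Ideal.add_mem _ (Ideal.sub_mem _ (Ideal.mul_mem_left _ _ hu1) (Ideal.mul_mem_left _ _ ht2))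
      (Ideal.mul_mem_left _ _ hu1)) (Ideal.mul_mem_right _ _ (Ideal.mul_mem_left _ _ ht2))) (Ideal.mul_mem_left _ _ hk₀)
  have key : IsUnit a ↔ IsUnit b := by
    constructor
    · intro hua
      by_contra hnb
      have hbm : b ∈ IsLocalRing.maximalIdeal 𝒪[E] := (IsLocalRing.mem_maximalIdeal _).2 hnb
      have : a ∈ IsLocalRing.maximalIdeal 𝒪[E] := by simpa using Ideal.add_mem _ hab hbm
      exact (IsLocalRing.mem_maximalIdeal _ |>.1 this) hua
    · intro hub
      by_contra hna
      have ham : a ∈ IsLocalRing.maximalIdeal 𝒪[E] := (IsLocalRing.mem_maximalIdeal _).2 hna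
      have : b ∈ IsLocalRing.maximalIdeal 𝒪[E] := by simpa using Ideal.sub_mem _ ham hab
      exact (IsLocalRing.mem_maximalIdeal _ |>.1 this) hub
  rw [key, and_self]

include hθ hk₀ hcoord in
/-- **`R` IS INVERSE-CLOSED IN `Λ`** (`Λ` is integral over the constants: `z = (a, jb + jcθ)` is a root of the monic cubic `(X − a)(X² − 2bX + (b² − c²k₀))` with unit constant
term when `z ∈ Λ^×`, so `z⁻¹` is a polynomial in `z` with constant coefficients). [cite: Neukirch1999, Ch. I §12] -/
theorem inv_mem_range_eval₂ {z : 𝒪[E] × O₁} (hzu : IsUnit z)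
    (hz : z ∈ (Polynomial.eval₂RingHom (RingHom.prod (RingHom.id 𝒪[E]) j) ((u, lam) : 𝒪[E] × O₁)).range) :
    (↑hzu.unit⁻¹ : 𝒪[E] × O₁) ∈ (Polynomial.eval₂RingHom (RingHom.prod (RingHom.id 𝒪[E]) j) ((u, lam) : 𝒪[E] × O₁)).range := by
  set R := (Polynomial.eval₂RingHom (RingHom.prod (RingHom.id 𝒪[E]) j) ((u, lam) : 𝒪[E] × O₁)).range with hR
  obtain ⟨⟨b, c⟩, hw, -⟩ := hcoord z.2
  simp only at hw
  -- the unit constant term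
  have hzu' := Prod.isUnit_iff.1 hzu
  have hua : IsUnit z.1 := hzu'.1
  have hub : IsUnit b := by
    have h := hzu'.2
    rw [hw, isUnit_add_mul_iff j θ hθ hk₀ hcoord] at h; exact h
  have hp0u : IsUnit (z.1 * (b * b - c * c * k₀)) := by
    refine hua.mul ?_
    by_contra hn
    have hm : c * c * k₀ ∈ IsLocalRing.maximalIdeal 𝒪[E] := Ideal.mul_mem_left _ _ hk₀
    have hn' : b * b - c * c * k₀ ∈ IsLocalRing.maximalIdeal 𝒪[E] := (IsLocalRing.mem_maximalIdeal _).2 hn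
    have : b * b ∈ IsLocalRing.maximalIdeal 𝒪[E] := by simpa using Ideal.add_mem _ hn' hm
    rcases (IsLocalRing.maximalIdeal.isMaximal 𝒪[E]).isPrime.mem_or_mem this with h | h <;>
      exact ((IsLocalRing.mem_maximalIdeal _).1 h) hub
  obtain ⟨p₀, hp₀⟩ := hp0u
  -- the cubic relation, written as `z · q(z) = (p₀, j p₀)` with `q(z) = z² − (a + 2b) z + (2ab + b² − c²k₀)`, `a = z.1`
  set qz : 𝒪[E] × O₁ := z * z - ((z.1 + 2 * b, j (z.1 + 2 * b)) : 𝒪[E] × O₁) * z +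
    (2 * z.1 * b + (b * b - c * c * k₀), j (2 * z.1 * b + (b * b - c * c * k₀))) with hqz
  have hrel : z * qz = ((↑p₀, j ↑p₀) : 𝒪[E] × O₁) := by
    rw [hp₀, hqz]
    have hθ2 : θ * θ = j k₀ := by rw [← sq, hθ]
    refine Prod.ext ?_ ?_
    · simp only [Prod.fst_mul, Prod.fst_sub, Prod.fst_add]; ring
    · simp only [Prod.snd_mul, Prod.snd_sub, Prod.snd_add, map_add, map_mul, map_sub, map_ofNat]
      rw [hw]
      linear_combination (j c * j c) * ((j b + j c * θ) - j z.1) * hθ2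
  -- hence `z⁻¹ = q(z) · (p₀⁻¹, j p₀⁻¹) ∈ R`
  have hqR : qz ∈ R := by
    rw [hqz]
    exact R.add_mem (R.sub_mem (R.mul_mem hz hz) (R.mul_mem (const_mem_range_eval₂ j u _) hz)) (const_mem_range_eval₂ j u _)
  have hone : (hzu.unit : 𝒪[E] × O₁) * (qz * ((↑p₀⁻¹, j ↑p₀⁻¹) : 𝒪[E] × O₁)) = 1 := by
    rw [IsUnit.unit_spec, ← mul_assoc, hrel, Prod.mk_mul_mk, ← map_mul, Units.mul_inv, map_one]; rfl
  rw [Units.inv_eq_of_mul_eq_one_right hone]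
  exact R.mul_mem hqR (const_mem_range_eval₂ j u _)

include hθ hk₀ hcoord h2 hD hlam hu1 ht2 in
/-- **`R = 𝒪[x]` IS A LOCAL RING** whose units are detected by the residue of the first coordinate. [cite: Neukirch1999, Ch. I §12] -/
theorem isLocalRing_range_eval₂ :
    IsLocalRing (Polynomial.eval₂RingHom (RingHom.prod (RingHom.id 𝒪[E]) j) ((u, lam) : 𝒪[E] × O₁)).range := by
  set R := (Polynomial.eval₂RingHom (RingHom.prod (RingHom.id 𝒪[E]) j) ((u, lam) : 𝒪[E] × O₁)).range with hR
  -- units of `R` ↔ units of `Λ` ↔ first coordinate a unit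
  have hunit : ∀ r : R, IsUnit r ↔ IsUnit (r : 𝒪[E] × O₁).1 := by
    intro r
    rw [← isUnit_iff_isUnit_fst_of_mem_range j θ hθ hk₀ hcoord u h2 hD hlam hu1 ht2 r.2]
    constructor
    · intro h; exact h.map R.subtype
    · intro h
      have hinv := inv_mem_range_eval₂ j θ hθ hk₀ hcoord u h r.2
      refine IsUnit.of_mul_eq_one ⟨_, hinv⟩ (Subtype.ext ?_)
      change (r : 𝒪[E] × O₁) * ↑h.unit⁻¹ = 1
      exact h.mul_val_inv
  haveI : Nontrivial R := by
    refine ⟨⟨0, 1, fun h => ?_⟩⟩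
    have := congrArg (fun r : R => (r : 𝒪[E] × O₁).1) h
    simp at this
  refine IsLocalRing.of_nonunits_add ?_
  intro a b ha hb
  rw [mem_nonunits_iff, hunit] at ha hb ⊢
  rw [Subring.coe_add, Prod.fst_add]
  intro hab
  have ham : (a : 𝒪[E] × O₁).1 ∈ IsLocalRing.maximalIdeal 𝒪[E] := (IsLocalRing.mem_maximalIdeal _).2 ha
  have hbm : (b : 𝒪[E] × O₁).1 ∈ IsLocalRing.maximalIdeal 𝒪[E] := (IsLocalRing.mem_maximalIdeal _).2 hb
  exact (IsLocalRing.mem_maximalIdeal _ |>.1 (Ideal.add_mem _ ham hbm)) hab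

include hθ hk₀ hcoord h2 hD hlam hu1 ht2 in
/-- **THE RESIDUE FIELD OF `R` IS `𝓀`**: `#k_R = q` (the residue of the first coordinate is onto `𝓀` with kernel the non-units). [cite: Neukirch1999, Ch. I §12] -/
theorem natCard_residueField_range_eval₂ :
    @Nat.card (@IsLocalRing.ResidueField (Polynomial.eval₂RingHom (RingHom.prod (RingHom.id 𝒪[E]) j) ((u, lam) : 𝒪[E] × O₁)).range _
      (isLocalRing_range_eval₂ j θ hθ hk₀ hcoord u h2 hD hlam hu1 ht2)) = Nat.card 𝓀[E] := by
  set R := (Polynomial.eval₂RingHom (RingHom.prod (RingHom.id 𝒪[E]) j) ((u, lam) : 𝒪[E] × O₁)).range with hR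
  letI := isLocalRing_range_eval₂ j θ hθ hk₀ hcoord u h2 hD hlam hu1 ht2
  set χ : R →+* 𝓀[E] := (IsLocalRing.residue 𝒪[E]).comp ((RingHom.fst 𝒪[E] O₁).comp R.subtype) with hχ
  have hχapp : ∀ r : R, χ r = IsLocalRing.residue 𝒪[E] (r : 𝒪[E] × O₁).1 := fun _ => rfl
  have hsurj : Function.Surjective χ := by
    intro x
    obtain ⟨c, rfl⟩ := IsLocalRing.residue_surjective x
    exact ⟨⟨(c, j c), const_mem_range_eval₂ j u c⟩, rfl⟩
  have hunit : ∀ r : R, IsUnit r ↔ IsUnit (r : 𝒪[E] × O₁).1 := by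
    intro r
    rw [← isUnit_iff_isUnit_fst_of_mem_range j θ hθ hk₀ hcoord u h2 hD hlam hu1 ht2 r.2]
    constructor
    · intro h; exact h.map R.subtype
    · intro h
      have hinv := inv_mem_range_eval₂ j θ hθ hk₀ hcoord u h r.2
      refine IsUnit.of_mul_eq_one ⟨_, hinv⟩ (Subtype.ext ?_)
      change (r : 𝒪[E] × O₁) * ↑h.unit⁻¹ = 1
      exact h.mul_val_inv
  have hker : RingHom.ker χ = IsLocalRing.maximalIdeal R := by
    ext r
    rw [RingHom.mem_ker, hχapp, IsLocalRing.residue_eq_zero_iff, IsLocalRing.mem_maximalIdeal, IsLocalRing.mem_maximalIdeal, mem_nonunits_iff,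
      mem_nonunits_iff, hunit]
  unfold IsLocalRing.ResidueField
  rw [← hker]
  exact Nat.card_congr (RingHom.quotientKerEquivOfSurjective hsurj).toEquiv

/-! ## §4 The unit index -/

include hθ hk₀ hcoord h2 hD hlam hu1 ht2 hϖ hn hN in
/-- **THE UNIT INDEX OF THE MONOGENIC ORDER `𝒪[x] ≤ 𝒪 × 𝒪[√k₀]`**: with `[Λ : R] = q^{N+n}`, `N + n ≥ 1`:  **`[Λ^× : R^×] = (q − 1) · q^{N+n−1}`**
(★ `index_range_units_map_prod_mul_eq` with the conductor `ϖ^{N+n}`, locality and residue field of §3).  At `𝒪 = 𝒪_w` (`q = N(v)²`) this is `[𝒪_A^× : 𝒪_w[δ]^×]` for the type-(2) eigen-algebra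
`A = L_w × K₁`. [cite: Neukirch1999, Ch. I §12] [cite: Rogawski1990, §4.9 Lemma 4.9.3 p. 56] -/
theorem index_units_range_eval₂_eq [IsDiscreteValuationRing 𝒪[E]] [Finite 𝓀[E]] (hNn : 1 ≤ N + n) :
    (Units.map ((Polynomial.eval₂RingHom (RingHom.prod (RingHom.id 𝒪[E]) j) ((u, lam) : 𝒪[E] × O₁)).range.subtype :
        (Polynomial.eval₂RingHom (RingHom.prod (RingHom.id 𝒪[E]) j) ((u, lam) : 𝒪[E] × O₁)).range →* 𝒪[E] × O₁)).range.index =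
      (Nat.card 𝓀[E] - 1) * Nat.card 𝓀[E] ^ (N + n - 1) := by
  set R := (Polynomial.eval₂RingHom (RingHom.prod (RingHom.id 𝒪[E]) j) ((u, lam) : 𝒪[E] × O₁)).range with hR
  letI := isLocalRing_range_eval₂ j θ hθ hk₀ hcoord u h2 hD hlam hu1 ht2
  have hq : 1 < Nat.card 𝓀[E] := Finite.one_lt_card
  have hres := natCard_residueField_range_eval₂ j θ hθ hk₀ hcoord u h2 hD hlam hu1 ht2
  have hcond := pow_mul_mem_range_eval₂ j θ hθ hcoord u h2 hD hlam hϖ hn hN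
  have hidx := index_range_eval₂_eq_pow j θ hθ hcoord u h2 hD hlam hϖ hn hN
  have key := index_range_units_map_prod_mul_eq j θ hθ hk₀ hcoord hϖ hNn R hres hcond
  rw [hidx] at key
  have hpow : Nat.card 𝓀[E] ^ (N + n) = Nat.card 𝓀[E] ^ (N + n - 1) * Nat.card 𝓀[E] := by
    rw [← pow_succ, Nat.sub_add_cancel hNn]
  rw [hpow, ← mul_assoc] at key
  exact Nat.eq_of_mul_eq_mul_right (by omega) key

end Literature.NumberTheory.Automorphic

end
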